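import Summits.Ventures.YMGap.Thresholds.OneLinkSDQuadScale
import Summits.Ventures.YMGap.Thresholds.OneLinkSDVariance
import HarnessLib

/-!
# Venture YMGap — the one-link modulus beyond first order, part 50: the SECOND MOMENT of the linear statistic by Schwinger–Dyson
# with the quadratic word kept in `L²` — `ω̃(N, r)` instead of `ω̂(N, r)`

HONEST FRAMING: venture file of the cell `pub-ymgap` (QuantumFields programme), strong-coupling LATTICE bookkeeping for `SU(N)`
lattice Yang–Mills; nothing about the continuum or the mass gap in the Clay sense.  No number of record by itself: it is the
primitive of the next lever of the one-link hierarchy (cell note `HOME/p2/ONE-LINK-HIERARCHY.md` §15 (2′)).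

WHAT.  `ν_B(dg) ∝ exp(N Re tr(gB)) dg` on `SU(N)`, `z_M(g) = tr(gM)`, `Z_M = √(E_ν|z_M|²)`.  `OneLinkSDVariance` proved
`Z_M² = ‖M‖_F²/N + ½∫Γ(Re tr(·B), |z_M|²) dν_B`, `Γ = −Re[z̄_M·tr(BgMg)] + Re[z̄_M·tr(MBᴴ)]`, and bounded BOTH words pointwise by
`‖B‖_F‖M‖_F|z_M|`, whence `Z_M ≤ ‖M‖_F(‖B‖_F/2 + √(‖B‖_F²/4 + 1/N))` (`= N ω̂(N,r)` for `M = B`, `‖B‖_F ≤ √N r`; `ω̂ → r²` as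
`N → ∞`, twice the Gross–Witten strong-phase mean `r²/2`).  Here the quadratic word is kept in `L²` (Cauchy–Schwarz) — it is
controlled by the Schwinger–Dyson second moment of quadratic words (`OneLinkSDQuadVariance.quad_sd_sq_le`, scale
`OneLinkSDQuadScale`: `W_BB ≤ N τ(N, r)`, `τ = O(r³)`):
* `sqrt_integral_normSq_trace_le_sd_quad`: `Z_M ≤ b/2 + √(b²/4 + ‖M‖_F²/N)` with `b = (W_{MB} + |tr(M Bᴴ)|)/2`,
  `W_{MB} = √(E_ν|tr(gMgB)|²)` — every `N ≥ 1`, every `B, M`;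
* `sqrt_integral_normSq_trace_le_sd_omegaTilde` (`M = B`, `N ≥ 3`): `Z_B ≤ N ω̃(N, ‖B‖_op)`,
  `ω̃(N,r) = (τ(N,r) + r²)/4 + √((τ(N,r) + r²)²/16 + r²/N²)` (`→ (r² + τ)/2` as `N → ∞`; at `N = 10`, `r = 0.258`: `ω̃ = 0.059` against
  `ω̂ = 0.075`, `−22 %`; the `Z`-terms are `23 %` of the `K₂B` body).
-/

noncomputable section

open scoped Matrix ComplexConjugate BigOperators ContDiff Matrix.Norms.Frobenius
open Matrix Complex Finset MeasureTheory ProbabilityTheory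
open Literature.MathematicalPhysics.QuantumFieldTheory
open Literature.MathematicalPhysics.QuantumFieldTheory.SUNBakryEmery

namespace Summit.Ventures.YMGap.OneLinkEigen

variable {N : ℕ}

/-- `b ↦ b/2 + √(b²/4 + c)` is monotone in `b ≥ 0` and `c`. [folklore] -/
theorem sol_mono {b b' c c' : ℝ} (hb : 0 ≤ b) (hbb : b ≤ b') (hcc : c ≤ c') :
    b / 2 + Real.sqrt (b ^ 2 / 4 + c) ≤ b' / 2 + Real.sqrt (b' ^ 2 / 4 + c') := by
  have := Real.sqrt_le_sqrt (show b ^ 2 / 4 + c ≤ b' ^ 2 / 4 + c' by nlinarith only [hb, hbb, hcc])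
  linarith only [this, hbb]

/-- **Second moment of the complex linear statistic by Schwinger–Dyson, the quadratic word kept in `L²`**: for every `B`, `M`
and `N ≥ 1`, `Z_M ≤ b/2 + √(b²/4 + ‖M‖_F²/N)` with `b = (√(E_ν|tr(gMgB)|²) + |tr(M Bᴴ)|)/2`. [folklore] -/
theorem sqrt_integral_normSq_trace_le_sd_quad (hN : N ≠ 0) (B M : Matrix (Fin N) (Fin N) ℂ) :
    Real.sqrt (∫ g, ‖((g : Matrix (Fin N) (Fin N) ℂ) * M).trace‖ ^ 2
        ∂(haarProbability (SUN N)).tilted (fun g => (N : ℝ) * ((g : Matrix (Fin N) (Fin N) ℂ) * B).trace.re)) ≤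
      ((Real.sqrt (∫ g, ‖((g : Matrix (Fin N) (Fin N) ℂ) * M * (g : Matrix (Fin N) (Fin N) ℂ) * B).trace‖ ^ 2
          ∂(haarProbability (SUN N)).tilted (fun g => (N : ℝ) * ((g : Matrix (Fin N) (Fin N) ℂ) * B).trace.re))
        + ‖(M * Bᴴ).trace‖) / 2) / 2 +
      Real.sqrt ((((Real.sqrt (∫ g, ‖((g : Matrix (Fin N) (Fin N) ℂ) * M * (g : Matrix (Fin N) (Fin N) ℂ) * B).trace‖ ^ 2
          ∂(haarProbability (SUN N)).tilted (fun g => (N : ℝ) * ((g : Matrix (Fin N) (Fin N) ℂ) * B).trace.re))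
        + ‖(M * Bᴴ).trace‖) / 2) ^ 2 / 4 + frobNorm M ^ 2 / N)) := by
  have hNpos : (0 : ℝ) < N := Nat.cast_pos.2 (Nat.pos_of_ne_zero hN)
  have hM0 := frobNorm_nonneg M
  set ν : Measure (SUN N) := (haarProbability (SUN N)).tilted (fun g => (N : ℝ) * ((g : Matrix (Fin N) (Fin N) ℂ) * B).trace.re) with hν
  have hexpi : Integrable (fun g : SUN N => Real.exp ((N : ℝ) * ((g : Matrix (Fin N) (Fin N) ℂ) * B).trace.re))
      (haarProbability (SUN N)) :=
    integrable_of_continuous_SUN (Real.continuous_exp.comp (continuous_restrict (contDiff_pot (N : ℝ) B))) _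
  haveI : IsProbabilityMeasure ν := isProbabilityMeasure_tilted hexpi
  set S : ℝ := ∫ g, ‖((g : Matrix (Fin N) (Fin N) ℂ) * M).trace‖ ^ 2 ∂ν with hS
  have hS0 : 0 ≤ S := integral_nonneg fun g => sq_nonneg _
  set Z : ℝ := Real.sqrt S with hZ
  have hZ0 : 0 ≤ Z := Real.sqrt_nonneg _
  have hZZ : Z ^ 2 = S := Real.sq_sqrt hS0
  set SW : ℝ := ∫ g, ‖((g : Matrix (Fin N) (Fin N) ℂ) * M * (g : Matrix (Fin N) (Fin N) ℂ) * B).trace‖ ^ 2 ∂ν with hSW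
  set W : ℝ := Real.sqrt SW with hW
  have hW0 : 0 ≤ W := Real.sqrt_nonneg _
  set c : ℝ := ‖(M * Bᴴ).trace‖ with hc
  have hc0 : 0 ≤ c := norm_nonneg _
  set b : ℝ := (W + c) / 2 with hb
  have htr : Continuous fun g : SUN N => ((g : Matrix (Fin N) (Fin N) ℂ) * M).trace :=
    (continuous_subtype_val.matrix_mul continuous_const).matrix_trace
  have hzc : Continuous fun g : SUN N => ‖((g : Matrix (Fin N) (Fin N) ℂ) * M).trace‖ := continuous_norm.comp htr
  have hwtr : Continuous fun g : SUN N => ((g : Matrix (Fin N) (Fin N) ℂ) * M * (g : Matrix (Fin N) (Fin N) ℂ) * B).trace :=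
    (((continuous_subtype_val.matrix_mul continuous_const).matrix_mul continuous_subtype_val).matrix_mul
      continuous_const).matrix_trace
  have hwc : Continuous fun g : SUN N => ‖((g : Matrix (Fin N) (Fin N) ℂ) * M * (g : Matrix (Fin N) (Fin N) ℂ) * B).trace‖ :=
    continuous_norm.comp hwtr
  -- (1) `∫ |z| ≤ Z` and `∫ |z| |w| ≤ Z W`
  have hintz : ∫ g, ‖((g : Matrix (Fin N) (Fin N) ℂ) * M).trace‖ ∂ν ≤ Z := by
    have h := integral_abs_le_sqrt hzc ν
    have e : (fun g : SUN N => |‖((g : Matrix (Fin N) (Fin N) ℂ) * M).trace‖|) =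
        fun g : SUN N => ‖((g : Matrix (Fin N) (Fin N) ℂ) * M).trace‖ := by
      funext g; exact abs_of_nonneg (norm_nonneg _)
    rw [e] at h
    exact h
  have hintzw : ∫ g, ‖((g : Matrix (Fin N) (Fin N) ℂ) * M).trace‖ *
      ‖((g : Matrix (Fin N) (Fin N) ℂ) * M * (g : Matrix (Fin N) (Fin N) ℂ) * B).trace‖ ∂ν ≤ Z * W := by
    have h := abs_integral_mul_le_sqrt hzc hwc ν
    exact (le_abs_self _).trans h
  -- (2) the Schwinger–Dyson identity `S = ‖M‖²/N + ½ ∫ Γ`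
  have hI := integral_reTrProdConj_eq hN B M M (N := N)
  rw [← hν] at hI
  have eS : S = ∫ g, (((g : Matrix (Fin N) (Fin N) ℂ) * M).trace *
      (starRingEnd ℂ) ((g : Matrix (Fin N) (Fin N) ℂ) * M).trace).re ∂ν := by
    rw [hS]
    refine integral_congr_ae (Filter.Eventually.of_forall fun g => ?_)
    simp only [Complex.mul_conj, Complex.ofReal_re, Complex.normSq_eq_norm_sq]
  have eMM : (M * Mᴴ).trace.re = frobNorm M ^ 2 := by
    rw [frobNorm_sq_eq_re_trace, Matrix.trace_mul_comm]
  -- (3) the pointwise bound `|Γ| ≤ |z| (|w| + c)`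
  have hGam : ∀ g : SUN N,
      |Gam (pot 1 B) (fun Q : Matrix (Fin N) (Fin N) ℂ => ((Q * M).trace * (starRingEnd ℂ) (Q * M).trace).re) g| ≤
        ‖((g : Matrix (Fin N) (Fin N) ℂ) * M).trace‖ *
            ‖((g : Matrix (Fin N) (Fin N) ℂ) * M * (g : Matrix (Fin N) (Fin N) ℂ) * B).trace‖
          + c * ‖((g : Matrix (Fin N) (Fin N) ℂ) * M).trace‖ := by
    intro g
    rw [Gam_potB_reTrProdConj hN B M M g]
    set z : ℂ := ((g : Matrix (Fin N) (Fin N) ℂ) * M).trace with hz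
    have ew : (B * (g : Matrix (Fin N) (Fin N) ℂ) * M * (g : Matrix (Fin N) (Fin N) ℂ)).trace =
        ((g : Matrix (Fin N) (Fin N) ℂ) * M * (g : Matrix (Fin N) (Fin N) ℂ) * B).trace := by
      rw [show B * (g : Matrix (Fin N) (Fin N) ℂ) * M * (g : Matrix (Fin N) (Fin N) ℂ) =
          B * ((g : Matrix (Fin N) (Fin N) ℂ) * M * (g : Matrix (Fin N) (Fin N) ℂ)) by simp only [Matrix.mul_assoc],
        Matrix.trace_mul_comm]
    rw [ew]
    set w : ℂ := ((g : Matrix (Fin N) (Fin N) ℂ) * M * (g : Matrix (Fin N) (Fin N) ℂ) * B).trace with hw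
    have t1 : |((starRingEnd ℂ) z * w).re| ≤ ‖z‖ * ‖w‖ := by
      refine (Complex.abs_re_le_norm _).trans ?_
      rw [norm_mul, Complex.norm_conj]
    have t2 : |((starRingEnd ℂ) z * (M * Bᴴ).trace).re| ≤ ‖z‖ * c := by
      refine (Complex.abs_re_le_norm _).trans ?_
      rw [norm_mul, Complex.norm_conj]
    have e : -(1 / 2) * (((starRingEnd ℂ) z * w).re + ((starRingEnd ℂ) z * w).re)
        + (1 / 2) * (((starRingEnd ℂ) z * (M * Bᴴ).trace).re + ((starRingEnd ℂ) z * (M * Bᴴ).trace).re) =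
        ((starRingEnd ℂ) z * (M * Bᴴ).trace).re - ((starRingEnd ℂ) z * w).re := by ring
    rw [e]
    refine (abs_sub _ _).trans ?_
    linarith only [t1, t2]
  -- (4) integrate
  have hGc : Continuous fun g : SUN N =>
      Gam (pot 1 B) (fun Q : Matrix (Fin N) (Fin N) ℂ => ((Q * M).trace * (starRingEnd ℂ) (Q * M).trace).re) g :=
    continuous_restrict (contDiff_Gam (contDiff_pot 1 B) (contDiff_reTrProdConj M M))
  have iG : Integrable (fun g : SUN N =>
      Gam (pot 1 B) (fun Q : Matrix (Fin N) (Fin N) ℂ => ((Q * M).trace * (starRingEnd ℂ) (Q * M).trace).re) g) ν :=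
    integrable_of_continuous_SUN hGc ν
  have iz : Integrable (fun g : SUN N => ‖((g : Matrix (Fin N) (Fin N) ℂ) * M).trace‖) ν := integrable_of_continuous_SUN hzc ν
  have izw : Integrable (fun g : SUN N => ‖((g : Matrix (Fin N) (Fin N) ℂ) * M).trace‖ *
      ‖((g : Matrix (Fin N) (Fin N) ℂ) * M * (g : Matrix (Fin N) (Fin N) ℂ) * B).trace‖) ν :=
    integrable_of_continuous_SUN (hzc.mul hwc) ν
  have hintG : |∫ g, Gam (pot 1 B) (fun Q : Matrix (Fin N) (Fin N) ℂ => ((Q * M).trace * (starRingEnd ℂ) (Q * M).trace).re) g ∂ν| ≤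
      (W + c) * Z := by
    calc |∫ g, Gam (pot 1 B) (fun Q : Matrix (Fin N) (Fin N) ℂ => ((Q * M).trace * (starRingEnd ℂ) (Q * M).trace).re) g ∂ν|
        ≤ ∫ g, |Gam (pot 1 B) (fun Q : Matrix (Fin N) (Fin N) ℂ => ((Q * M).trace * (starRingEnd ℂ) (Q * M).trace).re) g| ∂ν :=
          abs_integral_le_integral_abs
      _ ≤ ∫ g, (‖((g : Matrix (Fin N) (Fin N) ℂ) * M).trace‖ *
              ‖((g : Matrix (Fin N) (Fin N) ℂ) * M * (g : Matrix (Fin N) (Fin N) ℂ) * B).trace‖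
            + c * ‖((g : Matrix (Fin N) (Fin N) ℂ) * M).trace‖) ∂ν :=
          integral_mono iG.abs (izw.add (iz.const_mul _)) hGam
      _ = (∫ g, ‖((g : Matrix (Fin N) (Fin N) ℂ) * M).trace‖ *
              ‖((g : Matrix (Fin N) (Fin N) ℂ) * M * (g : Matrix (Fin N) (Fin N) ℂ) * B).trace‖ ∂ν)
            + c * ∫ g, ‖((g : Matrix (Fin N) (Fin N) ℂ) * M).trace‖ ∂ν := by
          rw [integral_add izw (iz.const_mul _), integral_const_mul]
      _ ≤ Z * W + c * Z := add_le_add hintzw (mul_le_mul_of_nonneg_left hintz hc0)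
      _ = (W + c) * Z := by ring
  -- (5) the quadratic inequality and its solution
  have hquad : Z ^ 2 ≤ frobNorm M ^ 2 / N + b * Z := by
    rw [hZZ, eS, hI, eMM, hb]
    have := (abs_le.1 hintG).2
    nlinarith only [this]
  exact le_of_sq_le_add_mul hquad

/-- **`Z_B ≤ N ω̃(N, ‖B‖_op)`**, `N ≥ 3`: the second moment of `tr(gB)` under `ν_B` with the quadratic word `tr(gBgB)` kept in
`L²` (`W_BB ≤ N τ(N, ‖B‖_op)`, `OneLinkSDQuadScale`) and `‖B‖_F² ≤ N‖B‖_op²`: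
`ω̃(N,r) = (τ + r²)/4 + √((τ + r²)²/16 + r²/N²)`, `τ = τ(N,r)` of `OneLinkSDQuadScale`. [folklore] -/
theorem sqrt_integral_normSq_trace_le_sd_omegaTilde (hN : 3 ≤ N) (B : Matrix (Fin N) (Fin N) ℂ) :
    Real.sqrt (∫ g, ‖((g : Matrix (Fin N) (Fin N) ℂ) * B).trace‖ ^ 2
        ∂(haarProbability (SUN N)).tilted (fun g => (N : ℝ) * ((g : Matrix (Fin N) (Fin N) ℂ) * B).trace.re)) ≤
      (N : ℝ) * (((matrixOpNorm B * ((matrixOpNorm B ^ 2 * (1 + matrixOpNorm B / 2 + Real.sqrt (matrixOpNorm B ^ 2 / 4 + 1 / (N : ℝ) ^ 2)) / (2 - 4 / (N : ℝ) ^ 2)) / 2 + Real.sqrt ((matrixOpNorm B ^ 2 * (1 + matrixOpNorm B / 2 + Real.sqrt (matrixOpNorm B ^ 2 / 4 + 1 / (N : ℝ) ^ 2)) / (2 - 4 / (N : ℝ) ^ 2)) ^ 2 / 4 + (matrixOpNorm B ^ 2 * (4 / (N : ℝ) ^ 2 + 2 * (matrixOpNorm B / 2 + Real.sqrt (matrixOpNorm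 B ^ 2 / 4 + 1 / (N : ℝ) ^ 2)) ^ 2) / (2 - 4 / (N : ℝ) ^ 2)))))
          + matrixOpNorm B ^ 2) / 4 +
        Real.sqrt (((matrixOpNorm B * ((matrixOpNorm B ^ 2 * (1 + matrixOpNorm B / 2 + Real.sqrt (matrixOpNorm B ^ 2 / 4 + 1 / (N : ℝ) ^ 2)) / (2 - 4 / (N : ℝ) ^ 2)) / 2 + Real.sqrt ((matrixOpNorm B ^ 2 * (1 + matrixOpNorm B / 2 + Real.sqrt (matrixOpNorm B ^ 2 / 4 + 1 / (N : ℝ) ^ 2)) / (2 - 4 / (N : ℝ) ^ 2)) ^ 2 / 4 + (matrixOpNorm B ^ 2 * (4 / (N : ℝ) ^ 2 + 2 * (matrixOpNorm B / 2 + Real.sqrt (matrixOpNorm B ^ 2 / 4 + 1 / (N : ℝ) ^ 2)) ^ 2) / (2 - 4 / (N : ℝ) ^ 2)))))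
          + matrixOpNorm B ^ 2) ^ 2 / 16 + matrixOpNorm B ^ 2 / (N : ℝ) ^ 2)) := by
  have hN0 : N ≠ 0 := by omega
  have h3 : (3 : ℝ) ≤ N := by exact_mod_cast hN
  have hNpos : (0 : ℝ) < N := by linarith
  have h := sqrt_integral_normSq_trace_le_sd_quad hN0 B B
  have hWle := sqrt_integral_normSq_quadBB_le_scale hN B
  set W : ℝ := Real.sqrt (∫ g, ‖((g : Matrix (Fin N) (Fin N) ℂ) * B * (g : Matrix (Fin N) (Fin N) ℂ) * B).trace‖ ^ 2
          ∂(haarProbability (SUN N)).tilted (fun g => (N : ℝ) * ((g : Matrix (Fin N) (Fin N) ℂ) * B).trace.re)) with hWdef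
  set r : ℝ := matrixOpNorm B with hr
  set τ : ℝ := r * ((r ^ 2 * (1 + r / 2 + Real.sqrt (r ^ 2 / 4 + 1 / (N : ℝ) ^ 2)) / (2 - 4 / (N : ℝ) ^ 2)) / 2 + Real.sqrt ((r ^ 2 * (1 + r / 2 + Real.sqrt (r ^ 2 / 4 + 1 / (N : ℝ) ^ 2)) / (2 - 4 / (N : ℝ) ^ 2)) ^ 2 / 4 + (r ^ 2 * (4 / (N : ℝ) ^ 2 + 2 * (r / 2 + Real.sqrt (r ^ 2 / 4 + 1 / (N : ℝ) ^ 2)) ^ 2) / (2 - 4 / (N : ℝ) ^ 2)))) with hτ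
  have hr0 : 0 ≤ r := matrixOpNorm_nonneg B
  have hB0 := frobNorm_nonneg B
  have hW0 : 0 ≤ W := Real.sqrt_nonneg _
  -- `‖tr(B Bᴴ)‖ ≤ ‖B‖_F² ≤ N r²`
  have hc : ‖(B * Bᴴ).trace‖ ≤ frobNorm B ^ 2 := by
    refine (norm_trace_mul_le _ _).trans ?_
    rw [frobNorm_conjTranspose, sq]
  have hBF : frobNorm B ^ 2 ≤ (N : ℝ) * r ^ 2 := by
    have h1 := frobNorm_le_sqrt_mul_matrixOpNorm B
    have h2 : 0 ≤ Real.sqrt N * matrixOpNorm B := by positivity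
    calc frobNorm B ^ 2 ≤ (Real.sqrt N * matrixOpNorm B) ^ 2 := pow_le_pow_left₀ hB0 h1 2
      _ = (N : ℝ) * r ^ 2 := by rw [mul_pow, Real.sq_sqrt hNpos.le, hr]
  -- monotonicity in `b` and `c`
  have hb : (W + ‖(B * Bᴴ).trace‖) / 2 ≤ ((N : ℝ) * τ + (N : ℝ) * r ^ 2) / 2 := by
    linarith only [hWle, hBF, hc]
  have hb0 : 0 ≤ (W + ‖(B * Bᴴ).trace‖) / 2 := by positivity
  have hcc : frobNorm B ^ 2 / N ≤ (N : ℝ) * r ^ 2 / N := div_le_div_of_nonneg_right hBF hNpos.le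
  have hmono := sol_mono hb0 hb hcc
  refine (h.trans hmono).trans (le_of_eq ?_)
  have e1 : (((N : ℝ) * τ + (N : ℝ) * r ^ 2) / 2) ^ 2 / 4 + (N : ℝ) * r ^ 2 / N =
      (N : ℝ) ^ 2 * ((τ + r ^ 2) ^ 2 / 16 + r ^ 2 / (N : ℝ) ^ 2) := by
    field_simp
    ring
  rw [e1, Real.sqrt_mul (by positivity), Real.sqrt_sq hNpos.le]
  ring

/-- **`‖B‖_F · Z_Δ ≤ ‖Δ‖_F · N ω̃(N, ‖B‖_op)`**, `N ≥ 3`, every `B, Δ`: the companion bound for the second linear statistic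
`tr(gΔ)` (the form of hypothesis `F2` of `levelTwo_algebraWAQ`), again with the quadratic word `tr(gΔgB)` kept in `L²`
(`‖B‖_F W_{ΔB} ≤ ‖Δ‖_F N τ`, `OneLinkSDQuadScale`) and `|tr(ΔBᴴ)| ≤ ‖Δ‖_F‖B‖_F`, `‖B‖_F² ≤ N‖B‖_op²`.  With
`sqrt_integral_normSq_trace_le_sd_omegaTilde` these are exactly the hypotheses `F1`, `F2` of `levelTwo_algebraWAQ` with `W := N ω̃`,
so the level-two assemblies (`cov_linear_le_levelTwoQ_explicit`, `…B_explicit`) re-instantiate verbatim with `ω̂ → ω̃` in the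
`W`-slots (the `2(E+¼)ω̂` term and the `(10E+½)Rω̂` term; not inside `ω⁺`). [folklore] -/
theorem frobNorm_mul_sqrt_integral_normSq_trace_le_sd_omegaTilde (hN : 3 ≤ N) (B Δ : Matrix (Fin N) (Fin N) ℂ) :
    frobNorm B * Real.sqrt (∫ g, ‖((g : Matrix (Fin N) (Fin N) ℂ) * Δ).trace‖ ^ 2
        ∂(haarProbability (SUN N)).tilted (fun g => (N : ℝ) * ((g : Matrix (Fin N) (Fin N) ℂ) * B).trace.re)) ≤
      frobNorm Δ * ((N : ℝ) * (((matrixOpNorm B * ((matrixOpNorm B ^ 2 * (1 + matrixOpNorm B / 2 + Real.sqrt (matrixOpNorm B ^ 2 / 4 + 1 / (N : ℝ) ^ 2)) / (2 - 4 / (N : ℝ) ^ 2)) / 2 + Real.sqrt ((matrixOpNorm B ^ 2 * (1 + matrixOpNorm B / 2 + Real.sqrt (matrixOpNorm B ^ 2 / 4 + 1 / (N : ℝ) ^ 2)) / (2 - 4 / (N : ℝ) ^ 2)) ^ 2 / 4 + (matrixOpNorm B ^ 2 * (4 / (N : ℝ) ^ 2 + 2 * (matrixOpNorm B / 2 + Real.sqrt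 (matrixOpNorm B ^ 2 / 4 + 1 / (N : ℝ) ^ 2)) ^ 2) / (2 - 4 / (N : ℝ) ^ 2)))))
          + matrixOpNorm B ^ 2) / 4 +
        Real.sqrt (((matrixOpNorm B * ((matrixOpNorm B ^ 2 * (1 + matrixOpNorm B / 2 + Real.sqrt (matrixOpNorm B ^ 2 / 4 + 1 / (N : ℝ) ^ 2)) / (2 - 4 / (N : ℝ) ^ 2)) / 2 + Real.sqrt ((matrixOpNorm B ^ 2 * (1 + matrixOpNorm B / 2 + Real.sqrt (matrixOpNorm B ^ 2 / 4 + 1 / (N : ℝ) ^ 2)) / (2 - 4 / (N : ℝ) ^ 2)) ^ 2 / 4 + (matrixOpNorm B ^ 2 * (4 / (N : ℝ) ^ 2 + 2 * (matrixOpNorm B / 2 + Real.sqrt (matrixOpNorm B ^ 2 / 4 + 1 / (N : ℝ) ^ 2)) ^ 2) / (2 - 4 / (N : ℝ) ^ 2)))))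
          + matrixOpNorm B ^ 2) ^ 2 / 16 + matrixOpNorm B ^ 2 / (N : ℝ) ^ 2))) := by
  have hN0 : N ≠ 0 := by omega
  have h3 : (3 : ℝ) ≤ N := by exact_mod_cast hN
  have hNpos : (0 : ℝ) < N := by linarith
  have h := sqrt_integral_normSq_trace_le_sd_quad hN0 B Δ
  have hWle := frobNorm_mul_sqrt_integral_normSq_quadDB_le hN B Δ
  set W : ℝ := Real.sqrt (∫ g, ‖((g : Matrix (Fin N) (Fin N) ℂ) * Δ * (g : Matrix (Fin N) (Fin N) ℂ) * B).trace‖ ^ 2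
          ∂(haarProbability (SUN N)).tilted (fun g => (N : ℝ) * ((g : Matrix (Fin N) (Fin N) ℂ) * B).trace.re)) with hWdef
  set Z : ℝ := Real.sqrt (∫ g, ‖((g : Matrix (Fin N) (Fin N) ℂ) * Δ).trace‖ ^ 2
          ∂(haarProbability (SUN N)).tilted (fun g => (N : ℝ) * ((g : Matrix (Fin N) (Fin N) ℂ) * B).trace.re)) with hZdef
  set r : ℝ := matrixOpNorm B with hr
  set τ : ℝ := r * ((r ^ 2 * (1 + r / 2 + Real.sqrt (r ^ 2 / 4 + 1 / (N : ℝ) ^ 2)) / (2 - 4 / (N : ℝ) ^ 2)) / 2 + Real.sqrt ((r ^ 2 * (1 + r / 2 + Real.sqrt (r ^ 2 / 4 + 1 / (N : ℝ) ^ 2)) / (2 - 4 / (N : ℝ) ^ 2)) ^ 2 / 4 + (r ^ 2 * (4 / (N : ℝ) ^ 2 + 2 * (r / 2 + Real.sqrt (r ^ 2 / 4 + 1 / (N : ℝ) ^ 2)) ^ 2) / (2 - 4 / (N : ℝ) ^ 2)))) with hτ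
  have hr0 : 0 ≤ r := matrixOpNorm_nonneg B
  have hnB0 : 0 ≤ frobNorm B := frobNorm_nonneg B
  have hnD0 : 0 ≤ frobNorm Δ := frobNorm_nonneg Δ
  have hW0 : 0 ≤ W := Real.sqrt_nonneg _
  have hc : ‖(Δ * Bᴴ).trace‖ ≤ frobNorm Δ * frobNorm B := by
    refine (norm_trace_mul_le _ _).trans ?_
    rw [frobNorm_conjTranspose]
  have hc0 : 0 ≤ ‖(Δ * Bᴴ).trace‖ := norm_nonneg _
  have hBF : frobNorm B ^ 2 ≤ (N : ℝ) * r ^ 2 := by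
    have h1 := frobNorm_le_sqrt_mul_matrixOpNorm B
    have h2 : 0 ≤ Real.sqrt N * matrixOpNorm B := mul_nonneg (Real.sqrt_nonneg _) hr0
    calc frobNorm B ^ 2 ≤ (Real.sqrt N * matrixOpNorm B) ^ 2 := pow_le_pow_left₀ hnB0 h1 2
      _ = (N : ℝ) * r ^ 2 := by rw [mul_pow, Real.sq_sqrt hNpos.le, hr]
  -- multiply the solved inequality by `‖B‖_F`
  obtain ⟨b, hb⟩ : ∃ b : ℝ, b = (W + ‖(Δ * Bᴴ).trace‖) / 2 := ⟨_, rfl⟩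
  rw [← hb] at h
  have hb0 : 0 ≤ b := by rw [hb]; exact div_nonneg (add_nonneg hW0 hc0) (by norm_num)
  have h1 : frobNorm B * Z ≤ (frobNorm B * b) / 2 + Real.sqrt ((frobNorm B * b) ^ 2 / 4 + frobNorm B ^ 2 * frobNorm Δ ^ 2 / N) := by
    have e : Real.sqrt ((frobNorm B * b) ^ 2 / 4 + frobNorm B ^ 2 * frobNorm Δ ^ 2 / N) =
        frobNorm B * Real.sqrt (b ^ 2 / 4 + frobNorm Δ ^ 2 / N) := by
      rw [show (frobNorm B * b) ^ 2 / 4 + frobNorm B ^ 2 * frobNorm Δ ^ 2 / N =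
          frobNorm B ^ 2 * (b ^ 2 / 4 + frobNorm Δ ^ 2 / N) by ring,
        Real.sqrt_mul (sq_nonneg _), Real.sqrt_sq hnB0]
    rw [e]
    have := mul_le_mul_of_nonneg_left h hnB0
    linarith only [this]
  have hbb : frobNorm B * b ≤ frobNorm Δ * ((N : ℝ) * τ + (N : ℝ) * r ^ 2) / 2 := by
    have t1 : frobNorm B * ‖(Δ * Bᴴ).trace‖ ≤ frobNorm Δ * ((N : ℝ) * r ^ 2) := by
      calc frobNorm B * ‖(Δ * Bᴴ).trace‖ ≤ frobNorm B * (frobNorm Δ * frobNorm B) := mul_le_mul_of_nonneg_left hc hnB0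
        _ = frobNorm Δ * frobNorm B ^ 2 := by ring
        _ ≤ frobNorm Δ * ((N : ℝ) * r ^ 2) := mul_le_mul_of_nonneg_left hBF hnD0
    have e : frobNorm B * b = (frobNorm B * W + frobNorm B * ‖(Δ * Bᴴ).trace‖) / 2 := by rw [hb]; ring
    rw [e]
    linarith only [hWle, t1]
  have hcc : frobNorm B ^ 2 * frobNorm Δ ^ 2 / N ≤ (N : ℝ) * r ^ 2 * frobNorm Δ ^ 2 / N :=
    div_le_div_of_nonneg_right (mul_le_mul_of_nonneg_right hBF (sq_nonneg _)) hNpos.le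
  have hmono := sol_mono (mul_nonneg hnB0 hb0) hbb hcc
  refine (h1.trans hmono).trans (le_of_eq ?_)
  have e1 : (frobNorm Δ * ((N : ℝ) * τ + (N : ℝ) * r ^ 2) / 2) ^ 2 / 4 + (N : ℝ) * r ^ 2 * frobNorm Δ ^ 2 / N =
      (frobNorm Δ * (N : ℝ)) ^ 2 * ((τ + r ^ 2) ^ 2 / 16 + r ^ 2 / (N : ℝ) ^ 2) := by
    field_simp
    ring
  rw [e1, Real.sqrt_mul (sq_nonneg _), Real.sqrt_sq (mul_nonneg hnD0 hNpos.le)]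
  ring

end Summit.Ventures.YMGap.OneLinkEigen
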